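import Literature.MathematicalPhysics.QuantumFieldTheory.Balaban1983to89.StrongCouplingKPWindow
import Literature.MathematicalPhysics.QuantumFieldTheory.SU2OneLinkIntegrals

/-!
# `StrongCouplingKPWindow.haarMeanSU2` IS the one-plaquette Haar mean (proof of the identification asserted in its docstring)

`Balaban1983to89/StrongCouplingKPWindow.lean` DEFINES the one-plaquette normaliser of the SU(2) Kotecký–Preiss certificate as
the real integral `haarMeanSU2 β_W = (2/π) ∫₀^π exp(β_W cos θ) sin²θ dθ` and says in its docstring that this is
`c₀(β_W) = ∫_{SU(2)} exp(β_t Re tr U) dU` (`β_W = 2β_t`) "by the Weyl integration formula for class functions on SU(2)".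
With the class-angle reduction of Haar measure now in the tree (`SU2OneLink.integral_trace_fun_haarProbability_su2`,
Montvay–Münster (3.96)–(3.97)) that sentence is a theorem: `haarMeanSU2_eq_integral_haarProbability`.  Consequently the
Mayer activity `exp(β_t Re tr U)/c₀ − 1` of the certificate's polymer model has Haar mean zero
(`integral_activity_eq_zero`), and `c₀ > 0` (`haarMeanSU2_pos`).

Observatory of the non-perturbative crossover; no mass-gap claim; 0 definitions, 0 named facts.
-/

noncomputable section

open MeasureTheory

namespace Literature.MathematicalPhysics.QuantumFieldTheory.Balaban1983to89.StrongCouplingKPWindow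

open Literature.MathematicalPhysics.QuantumFieldTheory.SU2OneLink

/-- **`c₀(β_W) = ∫_{SU(2)} exp(β_t Re tr U) dU` with `β_t = β_W/2`**: the certificate's real integral
`haarMeanSU2 β_W = (2/π)∫₀^π e^{β_W cos θ} sin²θ dθ` is the normalised-Haar mean of the one-plaquette Wilson weight
(Weyl / class-angle reduction on `SU(2)`, `tr U = 2cos θ`). [cite: MontvayMunster1994, §3.2.3 (3.96)-(3.97) p.121] -/
theorem haarMeanSU2_eq_integral_haarProbability (βW : ℝ) :
    haarMeanSU2 βW = ∫ U, Real.exp (βW / 2 * ((U : Matrix (Fin 2) (Fin 2) ℂ).trace).re)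
      ∂(haarProbability (Matrix.specialUnitaryGroup (Fin 2) ℂ)) := by
  rw [integral_exp_mul_re_trace_eq, haarMeanSU2]
  congr 1
  refine intervalIntegral.integral_congr fun θ _ => ?_
  congr 2
  ring

/-- `c₀(β_W) > 0` for `β_W ≥ 2` (read off the Laplace lower bound of the one-link partition function; true for all
`β_W`, this range suffices for positivity bookkeeping at the couplings where the bound is used).
[cite: MontvayMunster1994, §3.2.3 (3.97) p.121] -/
theorem haarMeanSU2_pos_of_two_le {βW : ℝ} (h : 2 ≤ βW) : 0 < haarMeanSU2 βW := by
  rw [haarMeanSU2_eq_integral_haarProbability]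
  exact integral_exp_mul_re_trace_pos (by linarith)

/-- `c₀(β_W) > 0` for EVERY `β_W` (the integrand `e^{β_W cos θ} sin²θ` is continuous, nonnegative and positive at
`θ = π/2`). [cite: MontvayMunster1994, §3.2.3 (3.97) p.121] -/
theorem haarMeanSU2_pos (βW : ℝ) : 0 < haarMeanSU2 βW := by
  unfold haarMeanSU2
  refine mul_pos (by positivity) ?_
  refine intervalIntegral.intervalIntegral_pos_of_pos_on ?_ (fun θ hθ => ?_) Real.pi_pos
  · exact ((by fun_prop : Continuous fun θ : ℝ => Real.exp (βW * Real.cos θ) * Real.sin θ ^ 2)).intervalIntegrable _ _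
  · exact mul_pos (Real.exp_pos _) (pow_pos (Real.sin_pos_of_pos_of_lt_pi hθ.1 hθ.2) 2)

/-- **The Mayer activity has Haar mean zero**: `∫_{SU(2)} (exp(β_t Re tr U)/c₀(β_W) − 1) dU = 0`, `β_t = β_W/2` — the
normalisation behind "`z(γ) = 0` unless `γ` is closed" in the certificate's polymer model.
[cite: MontvayMunster1994, §3.2.3 (3.97) p.121] -/
theorem integral_activity_eq_zero (βW : ℝ) :
    ∫ U, (Real.exp (βW / 2 * ((U : Matrix (Fin 2) (Fin 2) ℂ).trace).re) / haarMeanSU2 βW - 1)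
      ∂(haarProbability (Matrix.specialUnitaryGroup (Fin 2) ℂ)) = 0 := by
  have hc : haarMeanSU2 βW ≠ 0 := (haarMeanSU2_pos βW).ne'
  have hint : Integrable (fun U : Matrix.specialUnitaryGroup (Fin 2) ℂ =>
      Real.exp (βW / 2 * ((U : Matrix (Fin 2) (Fin 2) ℂ).trace).re))
      (haarProbability (Matrix.specialUnitaryGroup (Fin 2) ℂ)) :=
    (Real.continuous_exp.comp (continuous_const.mul continuous_re_trace)).integrable_of_hasCompactSupport
      (HasCompactSupport.of_compactSpace _)
  rw [integral_sub (hint.div_const _) (integrable_const _), integral_div, ← haarMeanSU2_eq_integral_haarProbability,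
    div_self hc, integral_const, probReal_univ, one_smul, sub_self]

end Literature.MathematicalPhysics.QuantumFieldTheory.Balaban1983to89.StrongCouplingKPWindow
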